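import Mathlib
import HarnessLib
import Summits.Ventures.LatticeQCDFlow.Exactness.SU2ResidualCovering
import Summits.Ventures.LatticeQCDFlow.Exactness.SU2ExactForceCovering
import Summits.Ventures.LatticeQCDFlow.Exactness.SU2ResidualMemberTranslation
import Summits.Ventures.LatticeQCDFlow.Exactness.SU2ResidualMemberSmooth

/-!
# THE COVERING IDENTITY FOR THE EXACT FORCE THROUGH THE LEARNED `SU(2)` RESIDUAL MEMBER: with a covering-natural, deck-covariant, differentiable conditioner, `Φ'_κ(V∘σ̂)_{e'} = Φ_κ(V)_{σ̂ e'}` — every torus, every covering `ℤ/L' → ℤ/L`, no size condition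

HONEST FRAMING: exact (Metropolis-corrected) sampling algorithms for lattice gauge theory;
figures of merit are autocorrelation/cost numbers at stated couplings and volumes; no
continuum-physics claim.

Venture `LatticeQCDFlow` (cell pub-lqcd), topic `Exactness`; FANOUT row 14 (`eng-flowhmc`, engine
`latflow.fthmc`, family B: FT-HMC through the LEARNED residual member `maps.residual_trained_scan` on
`SU(2)`, forces by autodiff of `S̃ = β S_W∘F − log J` along row 9's Pauli drift).  NEW WORK of the cell
over the tree (`SU2ResidualCovering`: `S̃'(V∘σ̂) = N·S̃(V)` for the learned member under (ρN);
`SU2PauliExactForcePull`: the covering identity for an abstract pair of actions;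
`SU2ResidualMemberTranslation`: the learned member is translation equivariant with invariant running
density when the weights are translation covariant; `SU2ResidualMemberSmooth`: the learned member is
link-smooth along link-smooth fields when the weights are; `SU2ExactForceCovering`: the LO special case
and `differentiable_expPauli_coe`); nothing is cited as a fact; no number.  Second file of the GEN-16
programme (VOLUME-UNIFORMITY for the LEARNED members).  The exact force, in the Pauli coordinates of
row 9's `su2LeapfrogHMCN` (the letters of GEN-14's `SU2ResidualExactForceRegular`):

  `Φ_κ(V)_l = κ · ( ∂/∂a_l^i S̃((l ↦ expPauli (a l)) · V) |_(a=0) )_(i=1,2,3)`.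

The ONLY properties of the network that enter, stated as hypotheses on the weight families `ρf`
(side `L`) and `ρf'` (side `L'`):

  (ρN)  `ρ'_s(V∘σ̂)(e', ν, t) = ρ_s(V)(σ̂ e', ν, t)` (covering naturality — shared convolutional
        weights with periodic padding, evaluated on both tori);
  (ρT)  `ρ'_s(W·t)(e, ν, b) = ρ'_s(W)(e + t, ν, b)` for the deck translations `σ t = 0` (translation
        covariance upstairs — the same engineering fact);
  (ρD)  the weights upstairs are differentiable along differentiable link fields (a smooth network).

* **`differentiableAt_ftAction_su2Residual_pauliDrift`** — under (ρD), for ANY schedule (layers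
  packaged VERBATIM as in `exists_layers_su2Residual`, positive booked densities) `a ↦ S̃(exp(a)·V)` is
  differentiable at EVERY momentum;
* `ftAction_su2Residual_deck_invariant` — under (ρT), for colourings `χ' = χ∘σ` every deck
  translation preserves `χ'`, so `S̃'(W·t) = S̃'(W)`;
* **`su2Residual_exactForce_pull`** — `φ : ZMod L' →+* ZMod L` onto, `χ' = χ∘σ`, (ρN) + (ρT) + (ρD),
  layers on both tori packaged VERBATIM, positive densities upstairs, every `β, κ, V, e'`:
  `Φ'_κ(V∘σ̂)_{e'} = Φ_κ(V)_{σ̂ e'}`.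

WHY IT MATTERS (the rest of the programme): with the LOCALITY of the force through the learned member
(receptive-field hypothesis (ρL), next files) the transplant principle `LatticeForceVolumeUniform`
moves the force at a link of an arbitrarily large torus to a FIXED reference torus, so the sup and
Lipschitz constants of GEN-14's `su2Residual_exactForce_regular` there serve every volume — for ONE
network evaluated on every torus.

NOT CLAIMED: conditioners violating (ρN)/(ρT) (global pooling, volume-dependent normalisation,
per-volume retrained weights — a different member on every torus, nothing uniform follows); that a
given trained network meets (ρD); fields upstairs that are not pull-backs; floating point; any number.
-/

noncomputable section

namespace Summit.Ventures.LatticeQCDFlow.Exactness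

open Real Set MeasureTheory InnerProductGeometry WithLp NormedSpace
open Literature.MathematicalPhysics.QuantumFieldTheory
open Literature.MathematicalPhysics.QuantumFieldTheory.Balaban1983to89.B10Eq18SigmaSU2Haar (expPauli)
open scoped Matrix Matrix.Norms.Operator

set_option backward.isDefEq.respectTransparency false

/-! ## The learned residual member: differentiability along the Pauli drift, deck invariance, the covering identity -/

section Residual

variable {d L L' : ℕ} (φ : ZMod L' →+* ZMod L) {X : Type*} [DecidableEq X]
  (χ : Site d L → X) (χ' : Site d L' → X) {σ : Type*} (μf : σ → Fin d) (bf : σ → X) (cf : σ → ℝ)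
  (ρf : σ → GaugeConfig d L (Matrix.specialUnitaryGroup (Fin 2) ℂ) → Edge d L → Fin d → Fin 2 → ℝ)
  (ρf' : σ → GaugeConfig d L' (Matrix.specialUnitaryGroup (Fin 2) ℂ) → Edge d L' → Fin d → Fin 2 → ℝ)

variable [NeZero L] [NeZero L']

omit [NeZero L'] in
/-- **The pulled-back action of the learned residual member is differentiable along the Pauli drift, at
every momentum** (positive booked densities, `S = β·S_W`; ANY schedule, layers packaged VERBATIM as in
`exists_layers_su2Residual`; (ρD): weights differentiable along differentiable link fields). -/
theorem differentiableAt_ftAction_su2Residual_pauliDrift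
    (hρD : ∀ (s : σ) (U : (Edge d L → EuclideanSpace ℝ (Fin 3)) → GaugeConfig d L (Matrix.specialUnitaryGroup (Fin 2) ℂ))
      (p₀ : Edge d L → EuclideanSpace ℝ (Fin 3)),
      (∀ e : Edge d L, DifferentiableAt ℝ (fun p => ((U p e : (Matrix.specialUnitaryGroup (Fin 2) ℂ)) : Matrix (Fin 2) (Fin 2) ℂ)) p₀) →
      ∀ (e : Edge d L) (ν : Fin d) (b : Fin 2), DifferentiableAt ℝ (fun p => ρf s (U p) e ν b) p₀)
    (sched : List σ)
    (layers : List ((GaugeConfig d L (Matrix.specialUnitaryGroup (Fin 2) ℂ) ≃ᵐ GaugeConfig d L (Matrix.specialUnitaryGroup (Fin 2) ℂ)) × (GaugeConfig d L (Matrix.specialUnitaryGroup (Fin 2) ℂ) → ℝ)))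
    (hmap :
      layers.map (fun Ly => ((Ly.1 : GaugeConfig d L (Matrix.specialUnitaryGroup (Fin 2) ℂ) → GaugeConfig d L (Matrix.specialUnitaryGroup (Fin 2) ℂ)), Ly.2)) =
        sched.map (fun s =>
          ((fun (V : GaugeConfig d L (Matrix.specialUnitaryGroup (Fin 2) ℂ)) (e : Edge d L) =>
        if e.2 = μf s ∧ χ e.1 = bf s then
          gaussUnit (geodesicKick (cf s) (∑ ν ∈ Finset.univ.erase e.2,
            (ρf s V e ν 0 • vecQuat (((V (Site.shift e.1 e.2, ν) * (V (Site.shift e.1 ν, e.2))⁻¹ * (V (e.1, ν))⁻¹)⁻¹ : Matrix.specialUnitaryGroup (Fin 2) ℂ) : Matrix (Fin 2) (Fin 2) ℂ) +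
              ρf s V e ν 1 • vecQuat ((((V (Site.shift (e.1 - Pi.single ν 1) e.2, ν))⁻¹ * (V (e.1 - Pi.single ν 1, e.2))⁻¹ * V (e.1 - Pi.single ν 1, ν))⁻¹ : Matrix.specialUnitaryGroup (Fin 2) ℂ) : Matrix (Fin 2) (Fin 2) ℂ)))
            (vecQuat ((V e : Matrix.specialUnitaryGroup (Fin 2) ℂ) : Matrix (Fin 2) (Fin 2) ℂ)))
        else V e),
           fun V : GaugeConfig d L (Matrix.specialUnitaryGroup (Fin 2) ℂ) => ∏ a : {e : Edge d L // e.2 = μf s ∧ χ e.1 = bf s},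
          (if Real.sin (angle (∑ ν ∈ Finset.univ.erase a.1.2,
            (ρf s V a.1 ν 0 • vecQuat (((V (Site.shift a.1.1 a.1.2, ν) * (V (Site.shift a.1.1 ν, a.1.2))⁻¹ * (V (a.1.1, ν))⁻¹)⁻¹ : Matrix.specialUnitaryGroup (Fin 2) ℂ) : Matrix (Fin 2) (Fin 2) ℂ) +
              ρf s V a.1 ν 1 • vecQuat ((((V (Site.shift (a.1.1 - Pi.single ν 1) a.1.2, ν))⁻¹ * (V (a.1.1 - Pi.single ν 1, a.1.2))⁻¹ * V (a.1.1 - Pi.single ν 1, ν))⁻¹ : Matrix.specialUnitaryGroup (Fin 2) ℂ) : Matrix (Fin 2) (Fin 2) ℂ))) (vecQuat ((V a.1 : Matrix.specialUnitaryGroup (Fin 2) ℂ) : Matrix (Fin 2) (Fin 2) ℂ))) = 0 then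
            (1 - cf s * ‖(∑ ν ∈ Finset.univ.erase a.1.2,
            (ρf s V a.1 ν 0 • vecQuat (((V (Site.shift a.1.1 a.1.2, ν) * (V (Site.shift a.1.1 ν, a.1.2))⁻¹ * (V (a.1.1, ν))⁻¹)⁻¹ : Matrix.specialUnitaryGroup (Fin 2) ℂ) : Matrix (Fin 2) (Fin 2) ℂ) +
              ρf s V a.1 ν 1 • vecQuat ((((V (Site.shift (a.1.1 - Pi.single ν 1) a.1.2, ν))⁻¹ * (V (a.1.1 - Pi.single ν 1, a.1.2))⁻¹ * V (a.1.1 - Pi.single ν 1, ν))⁻¹ : Matrix.specialUnitaryGroup (Fin 2) ℂ) : Matrix (Fin 2) (Fin 2) ℂ)))‖ * Real.cos (angle (∑ ν ∈ Finset.univ.erase a.1.2,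
            (ρf s V a.1 ν 0 • vecQuat (((V (Site.shift a.1.1 a.1.2, ν) * (V (Site.shift a.1.1 ν, a.1.2))⁻¹ * (V (a.1.1, ν))⁻¹)⁻¹ : Matrix.specialUnitaryGroup (Fin 2) ℂ) : Matrix (Fin 2) (Fin 2) ℂ) +
              ρf s V a.1 ν 1 • vecQuat ((((V (Site.shift (a.1.1 - Pi.single ν 1) a.1.2, ν))⁻¹ * (V (a.1.1 - Pi.single ν 1, a.1.2))⁻¹ * V (a.1.1 - Pi.single ν 1, ν))⁻¹ : Matrix.specialUnitaryGroup (Fin 2) ℂ) : Matrix (Fin 2) (Fin 2) ℂ))) (vecQuat ((V a.1 : Matrix.specialUnitaryGroup (Fin 2) ℂ) : Matrix (Fin 2) (Fin 2) ℂ)))) ^ 3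
          else kickJac (cf s * ‖(∑ ν ∈ Finset.univ.erase a.1.2,
            (ρf s V a.1 ν 0 • vecQuat (((V (Site.shift a.1.1 a.1.2, ν) * (V (Site.shift a.1.1 ν, a.1.2))⁻¹ * (V (a.1.1, ν))⁻¹)⁻¹ : Matrix.specialUnitaryGroup (Fin 2) ℂ) : Matrix (Fin 2) (Fin 2) ℂ) +
              ρf s V a.1 ν 1 • vecQuat ((((V (Site.shift (a.1.1 - Pi.single ν 1) a.1.2, ν))⁻¹ * (V (a.1.1 - Pi.single ν 1, a.1.2))⁻¹ * V (a.1.1 - Pi.single ν 1, ν))⁻¹ : Matrix.specialUnitaryGroup (Fin 2) ℂ) : Matrix (Fin 2) (Fin 2) ℂ)))‖) 2 (angle (∑ ν ∈ Finset.univ.erase a.1.2,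
            (ρf s V a.1 ν 0 • vecQuat (((V (Site.shift a.1.1 a.1.2, ν) * (V (Site.shift a.1.1 ν, a.1.2))⁻¹ * (V (a.1.1, ν))⁻¹)⁻¹ : Matrix.specialUnitaryGroup (Fin 2) ℂ) : Matrix (Fin 2) (Fin 2) ℂ) +
              ρf s V a.1 ν 1 • vecQuat ((((V (Site.shift (a.1.1 - Pi.single ν 1) a.1.2, ν))⁻¹ * (V (a.1.1 - Pi.single ν 1, a.1.2))⁻¹ * V (a.1.1 - Pi.single ν 1, ν))⁻¹ : Matrix.specialUnitaryGroup (Fin 2) ℂ) : Matrix (Fin 2) (Fin 2) ℂ))) (vecQuat ((V a.1 : Matrix.specialUnitaryGroup (Fin 2) ℂ) : Matrix (Fin 2) (Fin 2) ℂ)))))))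
    (hpos : ∀ Ly ∈ layers, ∀ V, 0 < Ly.2 V) (β : ℝ) (V : GaugeConfig d L (Matrix.specialUnitaryGroup (Fin 2) ℂ))
    (a₀ : Edge d L → EuclideanSpace ℝ (Fin 3)) :
    DifferentiableAt ℝ (fun a : Edge d L → EuclideanSpace ℝ (Fin 3) => β * wilsonAction (Matrix.specialUnitaryGroup (Fin 2) ℂ).subtype ((layers.foldr (fun Ly (F : GaugeConfig d L (Matrix.specialUnitaryGroup (Fin 2) ℂ) ≃ᵐ GaugeConfig d L (Matrix.specialUnitaryGroup (Fin 2) ℂ)) => Ly.1.trans F) (MeasurableEquiv.refl (GaugeConfig d L (Matrix.specialUnitaryGroup (Fin 2) ℂ)))) ((fun l : Edge d L => expPauli (a l)) * V)) - Real.log ((layers.foldr (fun Ly K => fun v => Ly.2 v * K (Ly.1 v)) (fun _ => (1 : ℝ))) ((fun l : Edge d L => expPauli (a l)) * V))) a₀ := by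
  have hU : ∀ e : Edge d L, DifferentiableAt ℝ (fun a : Edge d L → EuclideanSpace ℝ (Fin 3) =>
      (((((fun l : Edge d L => expPauli (a l)) * V) : GaugeConfig d L (Matrix.specialUnitaryGroup (Fin 2) ℂ)) e :
        Matrix.specialUnitaryGroup (Fin 2) ℂ) : Matrix (Fin 2) (Fin 2) ℂ)) a₀ := by
    intro e
    have h1 : (fun a : Edge d L → EuclideanSpace ℝ (Fin 3) =>
        (((((fun l : Edge d L => expPauli (a l)) * V) : GaugeConfig d L (Matrix.specialUnitaryGroup (Fin 2) ℂ)) e :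
          Matrix.specialUnitaryGroup (Fin 2) ℂ) : Matrix (Fin 2) (Fin 2) ℂ)) =
        fun a => ((expPauli (a e) : Matrix.specialUnitaryGroup (Fin 2) ℂ) : Matrix (Fin 2) (Fin 2) ℂ) *
          ((V e : Matrix.specialUnitaryGroup (Fin 2) ℂ) : Matrix (Fin 2) (Fin 2) ℂ) := by
      funext a
      simp only [Pi.mul_apply, WilsonFlow.coe_mul_SU]
    rw [h1]
    exact ((differentiable_expPauli_coe.comp (differentiable_apply (𝕜 := ℝ) e)).mul_const _).differentiableAt
  obtain ⟨hF, hJ⟩ := linkSmooth_su2Residual_member χ μf bf cf ρf hρD sched layers hmap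
    (fun a : Edge d L → EuclideanSpace ℝ (Fin 3) => ((fun l : Edge d L => expPauli (a l)) * V)) a₀ hU
  beta_reduce
  refine (differentiableAt_wilsonAction_su2_of_links β _ a₀ hF).sub ?_
  exact hJ.log (foldr_logDet_pos layers hpos _).ne'

omit [NeZero L] in
/-- **Deck translations leave the upstairs FT action of the learned member invariant**: for `σ t = 0`,
colourings `χ' = χ ∘ σ` (so `t` preserves `χ'`) and weights translation covariant under `t` (ρT),
`S̃'(W·t) = S̃'(W)` (`su2Residual_member_translate` and `S_W` translation invariant). -/
theorem ftAction_su2Residual_deck_invariant (hχ : ∀ x : Site d L', χ' x = χ (fun j => φ (x j)))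
    (sched : List σ)
    (layers' : List ((GaugeConfig d L' (Matrix.specialUnitaryGroup (Fin 2) ℂ) ≃ᵐ GaugeConfig d L' (Matrix.specialUnitaryGroup (Fin 2) ℂ)) × (GaugeConfig d L' (Matrix.specialUnitaryGroup (Fin 2) ℂ) → ℝ)))
    (hmap' :
      layers'.map (fun Ly => ((Ly.1 : GaugeConfig d L' (Matrix.specialUnitaryGroup (Fin 2) ℂ) → GaugeConfig d L' (Matrix.specialUnitaryGroup (Fin 2) ℂ)), Ly.2)) =
        sched.map (fun s =>
          ((fun (V : GaugeConfig d L' (Matrix.specialUnitaryGroup (Fin 2) ℂ)) (e : Edge d L') =>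
        if e.2 = μf s ∧ χ' e.1 = bf s then
          gaussUnit (geodesicKick (cf s) (∑ ν ∈ Finset.univ.erase e.2,
            (ρf' s V e ν 0 • vecQuat (((V (Site.shift e.1 e.2, ν) * (V (Site.shift e.1 ν, e.2))⁻¹ * (V (e.1, ν))⁻¹)⁻¹ : Matrix.specialUnitaryGroup (Fin 2) ℂ) : Matrix (Fin 2) (Fin 2) ℂ) +
              ρf' s V e ν 1 • vecQuat ((((V (Site.shift (e.1 - Pi.single ν 1) e.2, ν))⁻¹ * (V (e.1 - Pi.single ν 1, e.2))⁻¹ * V (e.1 - Pi.single ν 1, ν))⁻¹ : Matrix.specialUnitaryGroup (Fin 2) ℂ) : Matrix (Fin 2) (Fin 2) ℂ)))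
            (vecQuat ((V e : Matrix.specialUnitaryGroup (Fin 2) ℂ) : Matrix (Fin 2) (Fin 2) ℂ)))
        else V e),
           fun V : GaugeConfig d L' (Matrix.specialUnitaryGroup (Fin 2) ℂ) => ∏ a : {e : Edge d L' // e.2 = μf s ∧ χ' e.1 = bf s},
          (if Real.sin (angle (∑ ν ∈ Finset.univ.erase a.1.2,
            (ρf' s V a.1 ν 0 • vecQuat (((V (Site.shift a.1.1 a.1.2, ν) * (V (Site.shift a.1.1 ν, a.1.2))⁻¹ * (V (a.1.1, ν))⁻¹)⁻¹ : Matrix.specialUnitaryGroup (Fin 2) ℂ) : Matrix (Fin 2) (Fin 2) ℂ) +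
              ρf' s V a.1 ν 1 • vecQuat ((((V (Site.shift (a.1.1 - Pi.single ν 1) a.1.2, ν))⁻¹ * (V (a.1.1 - Pi.single ν 1, a.1.2))⁻¹ * V (a.1.1 - Pi.single ν 1, ν))⁻¹ : Matrix.specialUnitaryGroup (Fin 2) ℂ) : Matrix (Fin 2) (Fin 2) ℂ))) (vecQuat ((V a.1 : Matrix.specialUnitaryGroup (Fin 2) ℂ) : Matrix (Fin 2) (Fin 2) ℂ))) = 0 then
            (1 - cf s * ‖(∑ ν ∈ Finset.univ.erase a.1.2,
            (ρf' s V a.1 ν 0 • vecQuat (((V (Site.shift a.1.1 a.1.2, ν) * (V (Site.shift a.1.1 ν, a.1.2))⁻¹ * (V (a.1.1, ν))⁻¹)⁻¹ : Matrix.specialUnitaryGroup (Fin 2) ℂ) : Matrix (Fin 2) (Fin 2) ℂ) +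
              ρf' s V a.1 ν 1 • vecQuat ((((V (Site.shift (a.1.1 - Pi.single ν 1) a.1.2, ν))⁻¹ * (V (a.1.1 - Pi.single ν 1, a.1.2))⁻¹ * V (a.1.1 - Pi.single ν 1, ν))⁻¹ : Matrix.specialUnitaryGroup (Fin 2) ℂ) : Matrix (Fin 2) (Fin 2) ℂ)))‖ * Real.cos (angle (∑ ν ∈ Finset.univ.erase a.1.2,
            (ρf' s V a.1 ν 0 • vecQuat (((V (Site.shift a.1.1 a.1.2, ν) * (V (Site.shift a.1.1 ν, a.1.2))⁻¹ * (V (a.1.1, ν))⁻¹)⁻¹ : Matrix.specialUnitaryGroup (Fin 2) ℂ) : Matrix (Fin 2) (Fin 2) ℂ) +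
              ρf' s V a.1 ν 1 • vecQuat ((((V (Site.shift (a.1.1 - Pi.single ν 1) a.1.2, ν))⁻¹ * (V (a.1.1 - Pi.single ν 1, a.1.2))⁻¹ * V (a.1.1 - Pi.single ν 1, ν))⁻¹ : Matrix.specialUnitaryGroup (Fin 2) ℂ) : Matrix (Fin 2) (Fin 2) ℂ))) (vecQuat ((V a.1 : Matrix.specialUnitaryGroup (Fin 2) ℂ) : Matrix (Fin 2) (Fin 2) ℂ)))) ^ 3
          else kickJac (cf s * ‖(∑ ν ∈ Finset.univ.erase a.1.2,
            (ρf' s V a.1 ν 0 • vecQuat (((V (Site.shift a.1.1 a.1.2, ν) * (V (Site.shift a.1.1 ν, a.1.2))⁻¹ * (V (a.1.1, ν))⁻¹)⁻¹ : Matrix.specialUnitaryGroup (Fin 2) ℂ) : Matrix (Fin 2) (Fin 2) ℂ) +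
              ρf' s V a.1 ν 1 • vecQuat ((((V (Site.shift (a.1.1 - Pi.single ν 1) a.1.2, ν))⁻¹ * (V (a.1.1 - Pi.single ν 1, a.1.2))⁻¹ * V (a.1.1 - Pi.single ν 1, ν))⁻¹ : Matrix.specialUnitaryGroup (Fin 2) ℂ) : Matrix (Fin 2) (Fin 2) ℂ)))‖) 2 (angle (∑ ν ∈ Finset.univ.erase a.1.2,
            (ρf' s V a.1 ν 0 • vecQuat (((V (Site.shift a.1.1 a.1.2, ν) * (V (Site.shift a.1.1 ν, a.1.2))⁻¹ * (V (a.1.1, ν))⁻¹)⁻¹ : Matrix.specialUnitaryGroup (Fin 2) ℂ) : Matrix (Fin 2) (Fin 2) ℂ) +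
              ρf' s V a.1 ν 1 • vecQuat ((((V (Site.shift (a.1.1 - Pi.single ν 1) a.1.2, ν))⁻¹ * (V (a.1.1 - Pi.single ν 1, a.1.2))⁻¹ * V (a.1.1 - Pi.single ν 1, ν))⁻¹ : Matrix.specialUnitaryGroup (Fin 2) ℂ) : Matrix (Fin 2) (Fin 2) ℂ))) (vecQuat ((V a.1 : Matrix.specialUnitaryGroup (Fin 2) ℂ) : Matrix (Fin 2) (Fin 2) ℂ)))))))
    (β : ℝ) {t : Site d L'} (ht : (fun j => φ (t j)) = 0)
    (hρT : ∀ s (W : GaugeConfig d L' (Matrix.specialUnitaryGroup (Fin 2) ℂ)) (e : Edge d L') (ν : Fin d) (b : Fin 2),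
      ρf' s (fun e : Edge d L' => W (e.1 + t, e.2)) e ν b = ρf' s W (e.1 + t, e.2) ν b)
    (W : GaugeConfig d L' (Matrix.specialUnitaryGroup (Fin 2) ℂ)) :
    β * wilsonAction (Matrix.specialUnitaryGroup (Fin 2) ℂ).subtype ((layers'.foldr (fun Ly (F : GaugeConfig d L' (Matrix.specialUnitaryGroup (Fin 2) ℂ) ≃ᵐ GaugeConfig d L' (Matrix.specialUnitaryGroup (Fin 2) ℂ)) => Ly.1.trans F) (MeasurableEquiv.refl (GaugeConfig d L' (Matrix.specialUnitaryGroup (Fin 2) ℂ)))) (fun e : Edge d L' => W (e.1 + t, e.2))) - Real.log ((layers'.foldr (fun Ly K => fun v => Ly.2 v * K (Ly.1 v)) (fun _ => (1 : ℝ))) (fun e : Edge d L' => W (e.1 + t, e.2))) =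
      β * wilsonAction (Matrix.specialUnitaryGroup (Fin 2) ℂ).subtype ((layers'.foldr (fun Ly (F : GaugeConfig d L' (Matrix.specialUnitaryGroup (Fin 2) ℂ) ≃ᵐ GaugeConfig d L' (Matrix.specialUnitaryGroup (Fin 2) ℂ)) => Ly.1.trans F) (MeasurableEquiv.refl (GaugeConfig d L' (Matrix.specialUnitaryGroup (Fin 2) ℂ)))) W) - Real.log ((layers'.foldr (fun Ly K => fun v => Ly.2 v * K (Ly.1 v)) (fun _ => (1 : ℝ))) W) := by
  have hχt : ∀ x : Site d L', χ' (x + t) = χ' x := by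
    intro x
    have h : (fun j => φ ((x + t) j)) = fun j => φ (x j) := by
      funext j
      have hj : φ (t j) = 0 := congrFun ht j
      simp only [Pi.add_apply, map_add, hj, add_zero]
    rw [hχ, hχ, h]
  obtain ⟨hF, hJ⟩ := su2Residual_member_translate χ' μf bf cf ρf' t hχt hρT sched layers' hmap'
  rw [hF W, hJ W, wilsonAction_comp_translate]

/-- **THE COVERING IDENTITY FOR THE EXACT FORCE THROUGH THE LEARNED `SU(2)` RESIDUAL MEMBER.**
`φ : ZMod L' →+* ZMod L` onto (`L ∣ L'`, `φ = ZMod.castHom`), colourings `χ' = χ ∘ σ`, ANY schedule,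
layers on the `L`-torus and on the `L'`-torus packaged VERBATIM as in `exists_layers_su2Residual`
(positive densities upstairs), weights related by (ρN), translation covariant under the deck
translations upstairs (ρT) and differentiable along differentiable link fields upstairs (ρD); every
`β, κ`, every field `V` downstairs and every edge `e'` upstairs:
`Φ'_κ(V∘σ̂)_{e'} = Φ_κ(V)_{σ̂ e'}` — the exact force through the learned member of the pulled-back
field is the pull-back of the exact force. -/
theorem su2Residual_exactForce_pull (hχ : ∀ x : Site d L', χ' x = χ (fun j => φ (x j)))
    (hφ : Function.Surjective φ) (sched : List σ)
    (hρN : ∀ s ∈ sched, ∀ (V : GaugeConfig d L (Matrix.specialUnitaryGroup (Fin 2) ℂ)) (e : Edge d L') (ν : Fin d) (t : Fin 2),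
      ρf' s (fun e : Edge d L' => V (fun i => φ (e.1 i), e.2)) e ν t = ρf s V ((fun j => φ (e.1 j)), e.2) ν t)
    (hρT : ∀ t : Site d L', (fun j => φ (t j)) = 0 →
      ∀ s (W : GaugeConfig d L' (Matrix.specialUnitaryGroup (Fin 2) ℂ)) (e : Edge d L') (ν : Fin d) (b : Fin 2),
      ρf' s (fun e : Edge d L' => W (e.1 + t, e.2)) e ν b = ρf' s W (e.1 + t, e.2) ν b)
    (hρD' : ∀ (s : σ) (U : (Edge d L' → EuclideanSpace ℝ (Fin 3)) → GaugeConfig d L' (Matrix.specialUnitaryGroup (Fin 2) ℂ))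
      (p₀ : Edge d L' → EuclideanSpace ℝ (Fin 3)),
      (∀ e : Edge d L', DifferentiableAt ℝ (fun p => ((U p e : (Matrix.specialUnitaryGroup (Fin 2) ℂ)) : Matrix (Fin 2) (Fin 2) ℂ)) p₀) →
      ∀ (e : Edge d L') (ν : Fin d) (b : Fin 2), DifferentiableAt ℝ (fun p => ρf' s (U p) e ν b) p₀)
    (layers : List ((GaugeConfig d L (Matrix.specialUnitaryGroup (Fin 2) ℂ) ≃ᵐ GaugeConfig d L (Matrix.specialUnitaryGroup (Fin 2) ℂ)) × (GaugeConfig d L (Matrix.specialUnitaryGroup (Fin 2) ℂ) → ℝ)))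
    (layers' : List ((GaugeConfig d L' (Matrix.specialUnitaryGroup (Fin 2) ℂ) ≃ᵐ GaugeConfig d L' (Matrix.specialUnitaryGroup (Fin 2) ℂ)) × (GaugeConfig d L' (Matrix.specialUnitaryGroup (Fin 2) ℂ) → ℝ)))
    (hmap :
      layers.map (fun Ly => ((Ly.1 : GaugeConfig d L (Matrix.specialUnitaryGroup (Fin 2) ℂ) → GaugeConfig d L (Matrix.specialUnitaryGroup (Fin 2) ℂ)), Ly.2)) =
        sched.map (fun s =>
          ((fun (V : GaugeConfig d L (Matrix.specialUnitaryGroup (Fin 2) ℂ)) (e : Edge d L) =>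
        if e.2 = μf s ∧ χ e.1 = bf s then
          gaussUnit (geodesicKick (cf s) (∑ ν ∈ Finset.univ.erase e.2,
            (ρf s V e ν 0 • vecQuat (((V (Site.shift e.1 e.2, ν) * (V (Site.shift e.1 ν, e.2))⁻¹ * (V (e.1, ν))⁻¹)⁻¹ : Matrix.specialUnitaryGroup (Fin 2) ℂ) : Matrix (Fin 2) (Fin 2) ℂ) +
              ρf s V e ν 1 • vecQuat ((((V (Site.shift (e.1 - Pi.single ν 1) e.2, ν))⁻¹ * (V (e.1 - Pi.single ν 1, e.2))⁻¹ * V (e.1 - Pi.single ν 1, ν))⁻¹ : Matrix.specialUnitaryGroup (Fin 2) ℂ) : Matrix (Fin 2) (Fin 2) ℂ)))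
            (vecQuat ((V e : Matrix.specialUnitaryGroup (Fin 2) ℂ) : Matrix (Fin 2) (Fin 2) ℂ)))
        else V e),
           fun V : GaugeConfig d L (Matrix.specialUnitaryGroup (Fin 2) ℂ) => ∏ a : {e : Edge d L // e.2 = μf s ∧ χ e.1 = bf s},
          (if Real.sin (angle (∑ ν ∈ Finset.univ.erase a.1.2,
            (ρf s V a.1 ν 0 • vecQuat (((V (Site.shift a.1.1 a.1.2, ν) * (V (Site.shift a.1.1 ν, a.1.2))⁻¹ * (V (a.1.1, ν))⁻¹)⁻¹ : Matrix.specialUnitaryGroup (Fin 2) ℂ) : Matrix (Fin 2) (Fin 2) ℂ) +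
              ρf s V a.1 ν 1 • vecQuat ((((V (Site.shift (a.1.1 - Pi.single ν 1) a.1.2, ν))⁻¹ * (V (a.1.1 - Pi.single ν 1, a.1.2))⁻¹ * V (a.1.1 - Pi.single ν 1, ν))⁻¹ : Matrix.specialUnitaryGroup (Fin 2) ℂ) : Matrix (Fin 2) (Fin 2) ℂ))) (vecQuat ((V a.1 : Matrix.specialUnitaryGroup (Fin 2) ℂ) : Matrix (Fin 2) (Fin 2) ℂ))) = 0 then
            (1 - cf s * ‖(∑ ν ∈ Finset.univ.erase a.1.2,
            (ρf s V a.1 ν 0 • vecQuat (((V (Site.shift a.1.1 a.1.2, ν) * (V (Site.shift a.1.1 ν, a.1.2))⁻¹ * (V (a.1.1, ν))⁻¹)⁻¹ : Matrix.specialUnitaryGroup (Fin 2) ℂ) : Matrix (Fin 2) (Fin 2) ℂ) +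
              ρf s V a.1 ν 1 • vecQuat ((((V (Site.shift (a.1.1 - Pi.single ν 1) a.1.2, ν))⁻¹ * (V (a.1.1 - Pi.single ν 1, a.1.2))⁻¹ * V (a.1.1 - Pi.single ν 1, ν))⁻¹ : Matrix.specialUnitaryGroup (Fin 2) ℂ) : Matrix (Fin 2) (Fin 2) ℂ)))‖ * Real.cos (angle (∑ ν ∈ Finset.univ.erase a.1.2,
            (ρf s V a.1 ν 0 • vecQuat (((V (Site.shift a.1.1 a.1.2, ν) * (V (Site.shift a.1.1 ν, a.1.2))⁻¹ * (V (a.1.1, ν))⁻¹)⁻¹ : Matrix.specialUnitaryGroup (Fin 2) ℂ) : Matrix (Fin 2) (Fin 2) ℂ) +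
              ρf s V a.1 ν 1 • vecQuat ((((V (Site.shift (a.1.1 - Pi.single ν 1) a.1.2, ν))⁻¹ * (V (a.1.1 - Pi.single ν 1, a.1.2))⁻¹ * V (a.1.1 - Pi.single ν 1, ν))⁻¹ : Matrix.specialUnitaryGroup (Fin 2) ℂ) : Matrix (Fin 2) (Fin 2) ℂ))) (vecQuat ((V a.1 : Matrix.specialUnitaryGroup (Fin 2) ℂ) : Matrix (Fin 2) (Fin 2) ℂ)))) ^ 3
          else kickJac (cf s * ‖(∑ ν ∈ Finset.univ.erase a.1.2,
            (ρf s V a.1 ν 0 • vecQuat (((V (Site.shift a.1.1 a.1.2, ν) * (V (Site.shift a.1.1 ν, a.1.2))⁻¹ * (V (a.1.1, ν))⁻¹)⁻¹ : Matrix.specialUnitaryGroup (Fin 2) ℂ) : Matrix (Fin 2) (Fin 2) ℂ) +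
              ρf s V a.1 ν 1 • vecQuat ((((V (Site.shift (a.1.1 - Pi.single ν 1) a.1.2, ν))⁻¹ * (V (a.1.1 - Pi.single ν 1, a.1.2))⁻¹ * V (a.1.1 - Pi.single ν 1, ν))⁻¹ : Matrix.specialUnitaryGroup (Fin 2) ℂ) : Matrix (Fin 2) (Fin 2) ℂ)))‖) 2 (angle (∑ ν ∈ Finset.univ.erase a.1.2,
            (ρf s V a.1 ν 0 • vecQuat (((V (Site.shift a.1.1 a.1.2, ν) * (V (Site.shift a.1.1 ν, a.1.2))⁻¹ * (V (a.1.1, ν))⁻¹)⁻¹ : Matrix.specialUnitaryGroup (Fin 2) ℂ) : Matrix (Fin 2) (Fin 2) ℂ) +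
              ρf s V a.1 ν 1 • vecQuat ((((V (Site.shift (a.1.1 - Pi.single ν 1) a.1.2, ν))⁻¹ * (V (a.1.1 - Pi.single ν 1, a.1.2))⁻¹ * V (a.1.1 - Pi.single ν 1, ν))⁻¹ : Matrix.specialUnitaryGroup (Fin 2) ℂ) : Matrix (Fin 2) (Fin 2) ℂ))) (vecQuat ((V a.1 : Matrix.specialUnitaryGroup (Fin 2) ℂ) : Matrix (Fin 2) (Fin 2) ℂ)))))))
    (hmap' :
      layers'.map (fun Ly => ((Ly.1 : GaugeConfig d L' (Matrix.specialUnitaryGroup (Fin 2) ℂ) → GaugeConfig d L' (Matrix.specialUnitaryGroup (Fin 2) ℂ)), Ly.2)) =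
        sched.map (fun s =>
          ((fun (V : GaugeConfig d L' (Matrix.specialUnitaryGroup (Fin 2) ℂ)) (e : Edge d L') =>
        if e.2 = μf s ∧ χ' e.1 = bf s then
          gaussUnit (geodesicKick (cf s) (∑ ν ∈ Finset.univ.erase e.2,
            (ρf' s V e ν 0 • vecQuat (((V (Site.shift e.1 e.2, ν) * (V (Site.shift e.1 ν, e.2))⁻¹ * (V (e.1, ν))⁻¹)⁻¹ : Matrix.specialUnitaryGroup (Fin 2) ℂ) : Matrix (Fin 2) (Fin 2) ℂ) +
              ρf' s V e ν 1 • vecQuat ((((V (Site.shift (e.1 - Pi.single ν 1) e.2, ν))⁻¹ * (V (e.1 - Pi.single ν 1, e.2))⁻¹ * V (e.1 - Pi.single ν 1, ν))⁻¹ : Matrix.specialUnitaryGroup (Fin 2) ℂ) : Matrix (Fin 2) (Fin 2) ℂ)))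
            (vecQuat ((V e : Matrix.specialUnitaryGroup (Fin 2) ℂ) : Matrix (Fin 2) (Fin 2) ℂ)))
        else V e),
           fun V : GaugeConfig d L' (Matrix.specialUnitaryGroup (Fin 2) ℂ) => ∏ a : {e : Edge d L' // e.2 = μf s ∧ χ' e.1 = bf s},
          (if Real.sin (angle (∑ ν ∈ Finset.univ.erase a.1.2,
            (ρf' s V a.1 ν 0 • vecQuat (((V (Site.shift a.1.1 a.1.2, ν) * (V (Site.shift a.1.1 ν, a.1.2))⁻¹ * (V (a.1.1, ν))⁻¹)⁻¹ : Matrix.specialUnitaryGroup (Fin 2) ℂ) : Matrix (Fin 2) (Fin 2) ℂ) +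
              ρf' s V a.1 ν 1 • vecQuat ((((V (Site.shift (a.1.1 - Pi.single ν 1) a.1.2, ν))⁻¹ * (V (a.1.1 - Pi.single ν 1, a.1.2))⁻¹ * V (a.1.1 - Pi.single ν 1, ν))⁻¹ : Matrix.specialUnitaryGroup (Fin 2) ℂ) : Matrix (Fin 2) (Fin 2) ℂ))) (vecQuat ((V a.1 : Matrix.specialUnitaryGroup (Fin 2) ℂ) : Matrix (Fin 2) (Fin 2) ℂ))) = 0 then
            (1 - cf s * ‖(∑ ν ∈ Finset.univ.erase a.1.2,
            (ρf' s V a.1 ν 0 • vecQuat (((V (Site.shift a.1.1 a.1.2, ν) * (V (Site.shift a.1.1 ν, a.1.2))⁻¹ * (V (a.1.1, ν))⁻¹)⁻¹ : Matrix.specialUnitaryGroup (Fin 2) ℂ) : Matrix (Fin 2) (Fin 2) ℂ) +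
              ρf' s V a.1 ν 1 • vecQuat ((((V (Site.shift (a.1.1 - Pi.single ν 1) a.1.2, ν))⁻¹ * (V (a.1.1 - Pi.single ν 1, a.1.2))⁻¹ * V (a.1.1 - Pi.single ν 1, ν))⁻¹ : Matrix.specialUnitaryGroup (Fin 2) ℂ) : Matrix (Fin 2) (Fin 2) ℂ)))‖ * Real.cos (angle (∑ ν ∈ Finset.univ.erase a.1.2,
            (ρf' s V a.1 ν 0 • vecQuat (((V (Site.shift a.1.1 a.1.2, ν) * (V (Site.shift a.1.1 ν, a.1.2))⁻¹ * (V (a.1.1, ν))⁻¹)⁻¹ : Matrix.specialUnitaryGroup (Fin 2) ℂ) : Matrix (Fin 2) (Fin 2) ℂ) +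
              ρf' s V a.1 ν 1 • vecQuat ((((V (Site.shift (a.1.1 - Pi.single ν 1) a.1.2, ν))⁻¹ * (V (a.1.1 - Pi.single ν 1, a.1.2))⁻¹ * V (a.1.1 - Pi.single ν 1, ν))⁻¹ : Matrix.specialUnitaryGroup (Fin 2) ℂ) : Matrix (Fin 2) (Fin 2) ℂ))) (vecQuat ((V a.1 : Matrix.specialUnitaryGroup (Fin 2) ℂ) : Matrix (Fin 2) (Fin 2) ℂ)))) ^ 3
          else kickJac (cf s * ‖(∑ ν ∈ Finset.univ.erase a.1.2,
            (ρf' s V a.1 ν 0 • vecQuat (((V (Site.shift a.1.1 a.1.2, ν) * (V (Site.shift a.1.1 ν, a.1.2))⁻¹ * (V (a.1.1, ν))⁻¹)⁻¹ : Matrix.specialUnitaryGroup (Fin 2) ℂ) : Matrix (Fin 2) (Fin 2) ℂ) +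
              ρf' s V a.1 ν 1 • vecQuat ((((V (Site.shift (a.1.1 - Pi.single ν 1) a.1.2, ν))⁻¹ * (V (a.1.1 - Pi.single ν 1, a.1.2))⁻¹ * V (a.1.1 - Pi.single ν 1, ν))⁻¹ : Matrix.specialUnitaryGroup (Fin 2) ℂ) : Matrix (Fin 2) (Fin 2) ℂ)))‖) 2 (angle (∑ ν ∈ Finset.univ.erase a.1.2,
            (ρf' s V a.1 ν 0 • vecQuat (((V (Site.shift a.1.1 a.1.2, ν) * (V (Site.shift a.1.1 ν, a.1.2))⁻¹ * (V (a.1.1, ν))⁻¹)⁻¹ : Matrix.specialUnitaryGroup (Fin 2) ℂ) : Matrix (Fin 2) (Fin 2) ℂ) +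
              ρf' s V a.1 ν 1 • vecQuat ((((V (Site.shift (a.1.1 - Pi.single ν 1) a.1.2, ν))⁻¹ * (V (a.1.1 - Pi.single ν 1, a.1.2))⁻¹ * V (a.1.1 - Pi.single ν 1, ν))⁻¹ : Matrix.specialUnitaryGroup (Fin 2) ℂ) : Matrix (Fin 2) (Fin 2) ℂ))) (vecQuat ((V a.1 : Matrix.specialUnitaryGroup (Fin 2) ℂ) : Matrix (Fin 2) (Fin 2) ℂ)))))))
    (hpos' : ∀ Ly ∈ layers', ∀ V, 0 < Ly.2 V) (β κ : ℝ)
    (V : GaugeConfig d L (Matrix.specialUnitaryGroup (Fin 2) ℂ)) (e' : Edge d L') :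
    (fun (V : GaugeConfig d L' (Matrix.specialUnitaryGroup (Fin 2) ℂ)) (l : Edge d L') => κ • WithLp.toLp 2 (fun i : Fin 3 =>
        fderiv ℝ (fun a : Edge d L' → EuclideanSpace ℝ (Fin 3) => β * wilsonAction (Matrix.specialUnitaryGroup (Fin 2) ℂ).subtype ((layers'.foldr (fun Ly (F : GaugeConfig d L' (Matrix.specialUnitaryGroup (Fin 2) ℂ) ≃ᵐ GaugeConfig d L' (Matrix.specialUnitaryGroup (Fin 2) ℂ)) => Ly.1.trans F) (MeasurableEquiv.refl (GaugeConfig d L' (Matrix.specialUnitaryGroup (Fin 2) ℂ)))) ((fun l : Edge d L' => expPauli (a l)) * V)) - Real.log ((layers'.foldr (fun Ly K => fun v => Ly.2 v * K (Ly.1 v)) (fun _ => (1 : ℝ))) ((fun l : Edge d L' => expPauli (a l)) * V))) 0 (Pi.single l (EuclideanSpace.single i (1 : ℝ))))) (fun e : Edge d L' => V (fun i => φ (e.1 i), e.2)) e' =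
      (fun (V : GaugeConfig d L (Matrix.specialUnitaryGroup (Fin 2) ℂ)) (l : Edge d L) => κ • WithLp.toLp 2 (fun i : Fin 3 =>
        fderiv ℝ (fun a : Edge d L → EuclideanSpace ℝ (Fin 3) => β * wilsonAction (Matrix.specialUnitaryGroup (Fin 2) ℂ).subtype ((layers.foldr (fun Ly (F : GaugeConfig d L (Matrix.specialUnitaryGroup (Fin 2) ℂ) ≃ᵐ GaugeConfig d L (Matrix.specialUnitaryGroup (Fin 2) ℂ)) => Ly.1.trans F) (MeasurableEquiv.refl (GaugeConfig d L (Matrix.specialUnitaryGroup (Fin 2) ℂ)))) ((fun l : Edge d L => expPauli (a l)) * V)) - Real.log ((layers.foldr (fun Ly K => fun v => Ly.2 v * K (Ly.1 v)) (fun _ => (1 : ℝ))) ((fun l : Edge d L => expPauli (a l)) * V))) 0 (Pi.single l (EuclideanSpace.single i (1 : ℝ))))) V ((fun j => φ (e'.1 j)), e'.2) := by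
  have key : ∀ u : EuclideanSpace ℝ (Fin 3),
      fderiv ℝ (fun a : Edge d L' → EuclideanSpace ℝ (Fin 3) => β * wilsonAction (Matrix.specialUnitaryGroup (Fin 2) ℂ).subtype ((layers'.foldr (fun Ly (F : GaugeConfig d L' (Matrix.specialUnitaryGroup (Fin 2) ℂ) ≃ᵐ GaugeConfig d L' (Matrix.specialUnitaryGroup (Fin 2) ℂ)) => Ly.1.trans F) (MeasurableEquiv.refl (GaugeConfig d L' (Matrix.specialUnitaryGroup (Fin 2) ℂ)))) ((fun l : Edge d L' => expPauli (a l)) * (fun e : Edge d L' => V (fun i => φ (e.1 i), e.2)))) - Real.log ((layers'.foldr (fun Ly K => fun v => Ly.2 v * K (Ly.1 v)) (fun _ => (1 : ℝ))) ((fun l : Edge d L' => expPauli (a l)) * (fun e : Edge d L' => V (fun i => φ (e.1 i), e.2))))) 0 (Pi.single e' u) =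
        fderiv ℝ (fun a : Edge d L → EuclideanSpace ℝ (Fin 3) => β * wilsonAction (Matrix.specialUnitaryGroup (Fin 2) ℂ).subtype ((layers.foldr (fun Ly (F : GaugeConfig d L (Matrix.specialUnitaryGroup (Fin 2) ℂ) ≃ᵐ GaugeConfig d L (Matrix.specialUnitaryGroup (Fin 2) ℂ)) => Ly.1.trans F) (MeasurableEquiv.refl (GaugeConfig d L (Matrix.specialUnitaryGroup (Fin 2) ℂ)))) ((fun l : Edge d L => expPauli (a l)) * V)) - Real.log ((layers.foldr (fun Ly K => fun v => Ly.2 v * K (Ly.1 v)) (fun _ => (1 : ℝ))) ((fun l : Edge d L => expPauli (a l)) * V))) 0 (Pi.single ((fun j => φ (e'.1 j)), e'.2) u) :=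
    fun u => su2PauliExactForce_pull φ hφ
      (St := fun W : GaugeConfig d L (Matrix.specialUnitaryGroup (Fin 2) ℂ) => β * wilsonAction (Matrix.specialUnitaryGroup (Fin 2) ℂ).subtype ((layers.foldr (fun Ly (F : GaugeConfig d L (Matrix.specialUnitaryGroup (Fin 2) ℂ) ≃ᵐ GaugeConfig d L (Matrix.specialUnitaryGroup (Fin 2) ℂ)) => Ly.1.trans F) (MeasurableEquiv.refl (GaugeConfig d L (Matrix.specialUnitaryGroup (Fin 2) ℂ)))) W) - Real.log ((layers.foldr (fun Ly K => fun v => Ly.2 v * K (Ly.1 v)) (fun _ => (1 : ℝ))) W))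
      (St' := fun W : GaugeConfig d L' (Matrix.specialUnitaryGroup (Fin 2) ℂ) => β * wilsonAction (Matrix.specialUnitaryGroup (Fin 2) ℂ).subtype ((layers'.foldr (fun Ly (F : GaugeConfig d L' (Matrix.specialUnitaryGroup (Fin 2) ℂ) ≃ᵐ GaugeConfig d L' (Matrix.specialUnitaryGroup (Fin 2) ℂ)) => Ly.1.trans F) (MeasurableEquiv.refl (GaugeConfig d L' (Matrix.specialUnitaryGroup (Fin 2) ℂ)))) W) - Real.log ((layers'.foldr (fun Ly K => fun v => Ly.2 v * K (Ly.1 v)) (fun _ => (1 : ℝ))) W))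
      (fun W => ftAction_su2Residual_pull φ χ χ' μf bf cf ρf ρf' hχ hφ sched hρN layers layers' hmap hmap' β W)
      (fun t ht W => ftAction_su2Residual_deck_invariant φ χ χ' μf bf cf ρf' hχ sched layers' hmap' β ht (hρT t ht) W)
      V (by beta_reduce; exact differentiableAt_ftAction_su2Residual_pauliDrift χ' μf bf cf ρf' hρD' sched layers' hmap' hpos' β _ 0) e' u
  beta_reduce
  simp only [key]

end Residual

end Summit.Ventures.LatticeQCDFlow.Exactness
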